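import Summits.Ventures.QEC.Census.CertCheckBZAutSem
import Summits.Ventures.QEC.Census.BB.BB144.OrbitBZCover
import HarnessLib

/-!
# `bz_aut` with EXPLICIT PERMUTATION automorphisms — family-agnostic transport (`hφ`) for any CSS certificate
# (qec row 12, automorphism-orbit reduction: the generic `aut` field of CERT-FORMAT §5.5 / CERT-REQS R5)

The `bz_aut` closers in the tree discharge the two automorphism hypotheses of the engine soundness theorems
(`bzAut_lower_sound`, `bzAut_lower_sound_sem`, `bzAut_lower_sound_mitm`: transports `φ_a` with label action `ρ_a`,
hypotheses `hφ` / `hcover`) for ONE family: bivariate-bicycle codes `BB.Code ℓ m`, whose automorphisms are listed as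
group elements `(t₁,t₂) ∈ ℤ_ℓ × ℤ_m` (`Census/BZAutBBLower.lean`).  Kernel-A `bz_aut` certificates of every OTHER census
family (generalized-bicycle codes over `ℤ_N`, two-block group-algebra codes over `ℤ_{m₁} × ⋯ × ℤ_{m_r}`, …) carry their
automorphisms in the generic form of CERT-FORMAT §5.5: an explicit qubit permutation `perm` (bit `q ↦ perm[q]`) with
row maps `rowsX`, `rowsZ` (`H^X[rowsX[i]] = perm · H^X[i]`, `H^Z[rowsZ[i]] = perm · H^Z[i]`).  This file is the Lean
side of that generic form, so such certificates replay in the kernel with no typed family at all: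

* `permFun`, `permListOK n perm` — a permutation of `{0,…,n−1}` given as its table (length `n`, entries exactly
  `{0,…,n−1}`: the OR of `2^perm[q]` is `2^n − 1`), and `permEquiv n perm : Fin n ≃ Fin n` with
  `permEquiv_val : (permEquiv n perm q : ℕ) = perm[q]`; word transport `ofBits_permWord_permFun`;
* `rowMapOK n H perm rows` — the word-level automorphism check `H[rows[i]] = permWord perm H[i]` for every row, and
  its soundness `exists_submatrix_eq_of_rowMapOK : ∃ ρ, (rowMatrix n H).submatrix ρ (permEquiv n perm) = rowMatrix n H`
  (the row-map automorphism shape of type-12's `AutomorphismLabelAction.lean`);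
* `composeTab` / `wordPerm n gens w` — permutations given as WORDS in a few checked generators (for an abelian group
  `ℤ_{m₁} × ⋯ × ℤ_{m_r}` the `r` unit translations generate all `|G|` translations: the certificate checks `r`
  automorphisms instead of `|G| − 1`, the kernel composes tables), with `wordEquiv` and the agreement
  `wordEquiv_val`, and `exists_submatrix_eq_wordEquiv` (a word in row-map automorphisms is one);
* `AutGen` (= one `aut` entry: `perm`, `rowsSyn`, `rowsStab`), `autGensOK`, `autWordsOK`, and **`bzAut_perm_hφ`**: the
  `hφ` hypothesis of `bzAut_lower_sound` / `_sem` / `_mitm` for `α := {w // w ∈ words}`,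
  `φ_w z := z ∘ (wordEquiv n gens w)⁻¹`, `ρ_w := LX · (LZ ∘ (wordEquiv n gens w)⁻¹)ᵀ`, from `autGensOK` + `autWordsOK`
  (both `decide`) and the side's core structural verdict.

The matching label COVER over words (`coverAutPermOK`, `hcover`) and the assembled lower bounds are the companion file
`Census/BZAutPermCover.lean`.  HONEST FRAMING: no certificate is read here and no distance value is asserted; tier KERNEL,
axioms standard, no `native_decide`.  Sources: automorphism = qubit permutation ≡ check permutation
[Bravyi et al. 2024 SI §9.2]; symmetry reduction of minimum-weight enumeration [Grassl 2006 §2.2]; the Lean ingredients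
are type-12 `AutomorphismLabelAction` (p467242/p468376), `OrbitBZ`/`OrbitBZCover` (`permWord`, `ofBits_permWord`,
`labelWord`), type-10 `CertCheckBZAutSound` (p473245) / `CertCheckBZAutSem`.
-/

namespace Summit.Ventures.QEC.Census

open Matrix Literature.InformationTheory.QuantumCodes

/-! ## Permutations of the qubits given as tables -/

section PermTable

/-- Table lookup: `permFun perm q = perm[q]` (`0` past the end). (definition) -/
def permFun (perm : List ℕ) (q : ℕ) : ℕ := perm.getD q 0

/-- `perm` tabulates a permutation of `{0,…,n−1}`: it has length `n` and the set of its entries is exactly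
`{0,…,n−1}` — checked as "the OR of the `2^perm[q]` is `2^n − 1`" (kernel-cheap). (definition) -/
def permListOK (n : ℕ) (perm : List ℕ) : Bool :=
  (perm.length == n) && (perm.foldl (fun acc q => acc ||| 2 ^ q) 0 == 2 ^ n - 1)

/-- Bits of the OR-accumulator: bit `j` of `foldl (· ||| 2^·) acc l` is set iff it is set in `acc` or `j ∈ l`. -/
theorem testBit_foldl_or_two_pow (l : List ℕ) (acc j : ℕ) :
    (l.foldl (fun a q => a ||| 2 ^ q) acc).testBit j = (acc.testBit j || decide (j ∈ l)) := by
  induction l generalizing acc with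
  | nil => simp
  | cons q qs ih =>
    rw [List.foldl_cons, ih, Nat.testBit_or, Nat.testBit_two_pow]
    by_cases hqj : q = j
    · subst hqj; simp
    · have : ¬ j = q := fun h => hqj h.symm
      simp [hqj, this]

variable {n : ℕ} {perm : List ℕ}

/-- A valid table has length `n`. -/
theorem length_eq_of_permListOK (h : permListOK n perm = true) : perm.length = n := by
  simp only [permListOK, Bool.and_eq_true, beq_iff_eq] at h
  exact h.1

/-- The entries of a valid table are exactly `{0,…,n−1}`. -/
theorem mem_iff_lt_of_permListOK (h : permListOK n perm = true) (j : ℕ) : j ∈ perm ↔ j < n := by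
  simp only [permListOK, Bool.and_eq_true, beq_iff_eq] at h
  have key := congrArg (fun x => Nat.testBit x j) h.2
  simp only [testBit_foldl_or_two_pow, Nat.zero_testBit, Bool.false_or, Nat.testBit_two_pow_sub_one] at key
  simpa using key

/-- Every entry of a valid table is `< n`. -/
theorem permFun_lt_of_permListOK (h : permListOK n perm = true) {q : ℕ} (hq : q < n) : permFun perm q < n := by
  rw [← mem_iff_lt_of_permListOK h]
  have hq' : q < perm.length := by rw [length_eq_of_permListOK h]; exact hq
  rw [permFun, List.getD_eq_getElem?_getD, List.getElem?_eq_getElem hq', Option.getD_some]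
  exact List.getElem_mem hq'

/-- The tabulated map on `Fin n`. (definition) -/
def permFin (h : permListOK n perm = true) (q : Fin n) : Fin n :=
  ⟨permFun perm q, permFun_lt_of_permListOK h q.2⟩

/-- The tabulated map is onto (every `j < n` is an entry). -/
theorem permFin_surjective (h : permListOK n perm = true) : Function.Surjective (permFin h) := by
  intro j
  have hj : (j : ℕ) ∈ perm := (mem_iff_lt_of_permListOK h j).2 j.2
  obtain ⟨q, hq, hqj⟩ := List.getElem_of_mem hj
  refine ⟨⟨q, by rw [← length_eq_of_permListOK h]; exact hq⟩, Fin.ext ?_⟩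
  change permFun perm q = (j : ℕ)
  rw [permFun, List.getD_eq_getElem?_getD, List.getElem?_eq_getElem hq, Option.getD_some, hqj]

/-- Hence a bijection of `Fin n`. -/
theorem permFin_bijective (h : permListOK n perm = true) : Function.Bijective (permFin h) :=
  Finite.surjective_iff_bijective.1 (permFin_surjective h)

/-- **The permutation of `Fin n` tabulated by `perm`** (`q ↦ perm[q]`); the identity when `perm` is not a valid
table — a junk value no theorem uses (every statement assumes `permListOK n perm = true`). (definition) -/
noncomputable def permEquiv (n : ℕ) (perm : List ℕ) : Fin n ≃ Fin n :=
  if h : permListOK n perm = true then Equiv.ofBijective (permFin h) (permFin_bijective h) else Equiv.refl _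

/-- `permEquiv n perm q = perm[q]`. -/
theorem permEquiv_val (h : permListOK n perm = true) (q : Fin n) :
    ((permEquiv n perm q : Fin n) : ℕ) = permFun perm q := by
  rw [permEquiv, dif_pos h]
  rfl

/-- **Word transport along a tabulated permutation**: `ofBits n (permWord perm w n) = ofBits n w ∘ σ⁻¹`,
`σ = permEquiv n perm` (bit `q` of `w` moved to bit `perm[q]`). -/
theorem ofBits_permWord_permFun (h : permListOK n perm = true) (w : ℕ) :
    ofBits n (permWord (permFun perm) w n) = ofBits n w ∘ (permEquiv n perm).symm :=
  ofBits_permWord (permEquiv n perm) (permFun perm) (fun q => (permEquiv_val h q).symm) w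

end PermTable

/-! ## The word-level automorphism check of one matrix: `H[rows[i]] = perm · H[i]` -/

section RowMap

/-- **Automorphism check of one check matrix** (CERT-FORMAT §5.5 `aut[·].rowsX` / `rowsZ`): for every row `i` of
`H`, `rows[i]` is a row index and the word `H[rows[i]]` equals row `i` transported by the permutation
(`permWord perm H[i] n`, bit `q ↦ perm[q]`). (definition) -/
def rowMapOK (n : ℕ) (H : List ℕ) (perm rows : List ℕ) : Bool :=
  (List.range H.length).all fun i =>
    decide (rows.getD i 0 < H.length) && (H.getD (rows.getD i 0) 0 == permWord (permFun perm) (H.getD i 0) n)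

variable {n : ℕ}

/-- **Soundness of `rowMapOK`**: the tabulated permutation `σ` is a ROW-MAP AUTOMORPHISM of `rowMatrix n H`
(`(rowMatrix n H).submatrix ρ σ = rowMatrix n H` for the listed row map `ρ = rows`), the hypothesis shape of
`AutomorphismLabelAction.lean` / `CSSCode.zLogical_comp_equiv_symm_of_rowMap`. -/
theorem exists_submatrix_eq_of_rowMapOK {H perm rows : List ℕ} (hperm : permListOK n perm = true)
    (h : rowMapOK n H perm rows = true) :
    ∃ ρ : Fin H.length → Fin H.length, (rowMatrix n H).submatrix ρ (permEquiv n perm) = rowMatrix n H := by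
  simp only [rowMapOK, List.all_eq_true, List.mem_range, Bool.and_eq_true, decide_eq_true_eq, beq_iff_eq] at h
  refine ⟨fun i => ⟨rows.getD i 0, (h i i.2).1⟩, ?_⟩
  ext i j
  obtain ⟨hlt, hrow⟩ := h i i.2
  have e1 : H.getD (rows.getD i 0) 0 = H[rows.getD i 0] := by
    rw [List.getD_eq_getElem?_getD, List.getElem?_eq_getElem hlt, Option.getD_some]
  have e2 : H.getD i 0 = H[(i : ℕ)] := by
    rw [List.getD_eq_getElem?_getD, List.getElem?_eq_getElem i.2, Option.getD_some]
  rw [e1, e2] at hrow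
  simp only [submatrix_apply, rowMatrix]
  change ofBits n H[rows.getD (i : ℕ) 0] (permEquiv n perm j) = ofBits n H[(i : ℕ)] j
  rw [hrow, ofBits_permWord_permFun hperm]
  simp

end RowMap

/-! ## Permutations as words in checked generators -/

section Words

/-- The table of `σ_p ∘ σ_t` (`q ↦ p[t[q]]`) on `{0,…,n−1}`. (definition) -/
def composeTab (n : ℕ) (p t : List ℕ) : List ℕ := (List.range n).map fun q => permFun p (permFun t q)

/-- The permutation table of a WORD in generator tables: `wordPerm n gens [g₁,…,g_s] = σ_{g₁} ∘ ⋯ ∘ σ_{g_s}`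
(the empty word is the identity table `[0,…,n−1]`). (definition) -/
def wordPerm (n : ℕ) (gens : List (List ℕ)) : List ℕ → List ℕ
  | [] => List.range n
  | g :: gs => composeTab n (gens.getD g []) (wordPerm n gens gs)

/-- The permutation of `Fin n` denoted by a word: `σ_{g₁} ∘ ⋯ ∘ σ_{g_s}` with `σ_g = permEquiv n gens[g]`.
(definition) -/
noncomputable def wordEquiv (n : ℕ) (gens : List (List ℕ)) : List ℕ → (Fin n ≃ Fin n)
  | [] => Equiv.refl _
  | g :: gs => (wordEquiv n gens gs).trans (permEquiv n (gens.getD g []))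

variable {n : ℕ} {gens : List (List ℕ)}

/-- `composeTab` looks up `p[t[q]]` for `q < n`. -/
theorem permFun_composeTab (p t : List ℕ) {q : ℕ} (hq : q < n) :
    permFun (composeTab n p t) q = permFun p (permFun t q) := by
  rw [permFun, composeTab, List.getD_eq_getElem?_getD, List.getElem?_map, List.getElem?_range hq, Option.map_some,
    Option.getD_some]

/-- The identity table looks up `q` for `q < n`. -/
theorem permFun_range {q : ℕ} (hq : q < n) : permFun (List.range n) q = q := by
  rw [permFun, List.getD_eq_getElem?_getD, List.getElem?_range hq, Option.getD_some]

/-- **Agreement**: if every letter of the word names a valid generator table, the word's table computes the word's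
permutation: `(wordPerm n gens w)[q] = wordEquiv n gens w q`. -/
theorem wordEquiv_val (hgens : ∀ g ∈ gens, permListOK n g = true) :
    ∀ (w : List ℕ), (∀ g ∈ w, g < gens.length) →
      ∀ q : Fin n, permFun (wordPerm n gens w) q = ((wordEquiv n gens w q : Fin n) : ℕ)
  | [], _, q => by simp [wordPerm, wordEquiv, permFun_range q.2]
  | g :: gs, hw, q => by
    have hg : g < gens.length := hw g (by simp)
    have hgs : ∀ g' ∈ gs, g' < gens.length := fun g' hg' => hw g' (by simp [hg'])
    have hval : gens.getD g [] = gens[g] := by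
      rw [List.getD_eq_getElem?_getD, List.getElem?_eq_getElem hg, Option.getD_some]
    have hok : permListOK n (gens.getD g []) = true := by
      rw [hval]; exact hgens _ (List.getElem_mem hg)
    rw [wordPerm, wordEquiv, permFun_composeTab _ _ q.2, wordEquiv_val hgens gs hgs q, Equiv.trans_apply,
      permEquiv_val hok]

/-- **A word in row-map automorphisms is a row-map automorphism** of `rowMatrix n H` (some row map), given the
generators' checks `rowMapOK n H gens[g] rows[g]`. -/
theorem exists_submatrix_eq_wordEquiv {H : List ℕ} {rows : List (List ℕ)}
    (hgens : ∀ g ∈ gens, permListOK n g = true)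
    (hrows : ∀ g : ℕ, (hg : g < gens.length) → rowMapOK n H gens[g] (rows.getD g []) = true) :
    ∀ (w : List ℕ), (∀ g ∈ w, g < gens.length) →
      ∃ ρ : Fin H.length → Fin H.length, (rowMatrix n H).submatrix ρ (wordEquiv n gens w) = rowMatrix n H
  | [], _ => ⟨id, by simp [wordEquiv]⟩
  | g :: gs, hw => by
    have hg : g < gens.length := hw g (by simp)
    have hgs : ∀ g' ∈ gs, g' < gens.length := fun g' hg' => hw g' (by simp [hg'])
    obtain ⟨ρ₁, h₁⟩ := exists_submatrix_eq_wordEquiv hgens hrows gs hgs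
    have hval : gens.getD g [] = gens[g] := by
      rw [List.getD_eq_getElem?_getD, List.getElem?_eq_getElem hg, Option.getD_some]
    obtain ⟨ρ₂, h₂⟩ := exists_submatrix_eq_of_rowMapOK (hgens _ (List.getElem_mem hg)) (hrows g hg)
    refine ⟨ρ₂ ∘ ρ₁, ?_⟩
    rw [wordEquiv, hval]
    calc (rowMatrix n H).submatrix (ρ₂ ∘ ρ₁) ((wordEquiv n gens gs).trans (permEquiv n gens[g]))
        = ((rowMatrix n H).submatrix ρ₂ (permEquiv n gens[g])).submatrix ρ₁ (wordEquiv n gens gs) := by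
          rw [submatrix_submatrix]; rfl
      _ = rowMatrix n H := by rw [h₂, h₁]

end Words

/-! ## Certificate entries and the transport hypothesis `hφ` -/

section Transport

/-- One automorphism GENERATOR of a `bz_aut` certificate, side-oriented: the qubit permutation table and its row
maps on the SYNDROME matrix and on the STABILIZER matrix of the side (side `Z`: `rowsSyn = aut.rowsX`,
`rowsStab = aut.rowsZ`; side `X`: the other way round). (structure) -/
structure AutGen where
  /-- permutation table: bit `q ↦ perm[q]` -/
  perm : List ℕ
  /-- row map on the syndrome matrix: `Hsyn[rowsSyn[i]] = perm · Hsyn[i]` -/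
  rowsSyn : List ℕ
  /-- row map on the stabilizer matrix: `Hstab[rowsStab[i]] = perm · Hstab[i]` -/
  rowsStab : List ℕ

/-- **The generator check**: every generator is a valid permutation table and a row-map automorphism of BOTH check
matrices. (definition, `decide`) -/
def autGensOK (n : ℕ) (Hsyn Hstab : List ℕ) (gens : List AutGen) : Bool :=
  gens.all fun a => permListOK n a.perm && rowMapOK n Hsyn a.perm a.rowsSyn && rowMapOK n Hstab a.perm a.rowsStab

/-- **The word check**: every letter of every word names a generator. (definition, `decide`) -/
def autWordsOK (ngens : ℕ) (words : List (List ℕ)) : Bool :=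
  words.all fun w => w.all fun g => decide (g < ngens)

variable {n : ℕ}

/-- The generator tables of a generator list. (definition, reducible abbreviation) -/
abbrev autPerms (gens : List AutGen) : List (List ℕ) := gens.map AutGen.perm

/-- Unpacking `autGensOK`: valid tables. -/
theorem permListOK_of_autGensOK {Hsyn Hstab : List ℕ} {gens : List AutGen}
    (h : autGensOK n Hsyn Hstab gens = true) : ∀ g ∈ autPerms gens, permListOK n g = true := by
  simp only [autGensOK, List.all_eq_true, Bool.and_eq_true] at h
  intro g hg
  obtain ⟨a, ha, rfl⟩ := List.mem_map.1 hg
  exact (h a ha).1.1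

/-- Unpacking `autGensOK`: the syndrome-matrix row maps. -/
theorem rowMapOK_syn_of_autGensOK {Hsyn Hstab : List ℕ} {gens : List AutGen}
    (h : autGensOK n Hsyn Hstab gens = true) (g : ℕ) (hg : g < (autPerms gens).length) :
    rowMapOK n Hsyn (autPerms gens)[g] ((gens.map AutGen.rowsSyn).getD g []) = true := by
  simp only [autGensOK, List.all_eq_true, Bool.and_eq_true] at h
  have hg' : g < gens.length := by simpa using hg
  have := (h gens[g] (List.getElem_mem hg')).1.2
  simpa [List.getElem_map, List.getD_eq_getElem?_getD, List.getElem?_map, List.getElem?_eq_getElem hg'] using this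

/-- Unpacking `autGensOK`: the stabilizer-matrix row maps. -/
theorem rowMapOK_stab_of_autGensOK {Hsyn Hstab : List ℕ} {gens : List AutGen}
    (h : autGensOK n Hsyn Hstab gens = true) (g : ℕ) (hg : g < (autPerms gens).length) :
    rowMapOK n Hstab (autPerms gens)[g] ((gens.map AutGen.rowsStab).getD g []) = true := by
  simp only [autGensOK, List.all_eq_true, Bool.and_eq_true] at h
  have hg' : g < gens.length := by simpa using hg
  have := (h gens[g] (List.getElem_mem hg')).2
  simpa [List.getElem_map, List.getD_eq_getElem?_getD, List.getElem?_map, List.getElem?_eq_getElem hg'] using this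

/-- Unpacking `autWordsOK`. -/
theorem lt_of_autWordsOK {ngens : ℕ} {words : List (List ℕ)} (h : autWordsOK ngens words = true)
    {w : List ℕ} (hw : w ∈ words) : ∀ g ∈ w, g < ngens := by
  simp only [autWordsOK, List.all_eq_true, decide_eq_true_eq] at h
  exact h w hw

/-- **`hφ` for explicit-permutation automorphisms, any engine, any CSS certificate.**  Commuting check words on `n`
qubits, the side's core structural verdict (rank certificates, pairing `LX·LZᵀ = 1`, dimension count), checked
generators (`autGensOK`) and words (`autWordsOK`): transport by `(wordEquiv n gens w)⁻¹` maps a non-trivial logical of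
the side to a non-trivial logical of the same weight whose label is `ρ_w ·` the label,
`ρ_w = LX · (LZ ∘ (wordEquiv n gens w)⁻¹)ᵀ` (`LX = ldMat n L Ld`, `LZ = (logVec n L ·)` as in type-10's files) — the
`hφ` hypothesis of `bzAut_lower_sound` / `bzAut_lower_sound_sem` / `bzAut_lower_sound_mitm` for `α := {w // w ∈ words}`. -/
theorem bzAut_perm_hφ
    {Hsyn Hstab : List ℕ} {rcY rcS : RankCert} {L Ld : List ℕ} {ew : Option (List ℕ)}
    (hcomm : rowMatrix n Hsyn * (rowMatrix n Hstab)ᵀ = 0)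
    (hcore : bzCoreOK n Hsyn Hstab rcY rcS L Ld ew = true)
    {gens : List AutGen} (hgens : autGensOK n Hsyn Hstab gens = true)
    {words : List (List ℕ)} (hwords : autWordsOK gens.length words = true) :
    ∀ (a : {w : List ℕ // w ∈ words}) (z : Fin n → ZMod 2),
      rowMatrix n Hsyn *ᵥ z = 0 → z ∉ rowSpace (rowMatrix n Hstab) →
      rowMatrix n Hsyn *ᵥ (z ∘ (wordEquiv n (autPerms gens) a.1).symm) = 0 ∧
        z ∘ (wordEquiv n (autPerms gens) a.1).symm ∉ rowSpace (rowMatrix n Hstab) ∧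
        hammingNorm (z ∘ (wordEquiv n (autPerms gens) a.1).symm) = hammingNorm z ∧
        ldMat n L Ld *ᵥ (z ∘ (wordEquiv n (autPerms gens) a.1).symm) =
          (ldMat n L Ld * (Matrix.submatrix (fun i => logVec n L i : Matrix (Fin L.length) (Fin n) (ZMod 2)) id
            (wordEquiv n (autPerms gens) a.1).symm)ᵀ) *ᵥ (ldMat n L Ld *ᵥ z) := by
  have hcore' := hcore
  simp only [bzCoreOK, Bool.and_eq_true, beq_iff_eq] at hcore'
  obtain ⟨⟨⟨⟨hY, hS⟩, hL⟩, hdim⟩, -⟩ := hcore'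
  let C : CSSCode (Fin Hsyn.length) (Fin Hstab.length) (Fin n) :=
    CSSCode.ofMatrices (rowMatrix n Hsyn) (rowMatrix n Hstab) hcomm
  have hpair : ldMat n L Ld * (fun i => logVec n L i : Matrix (Fin L.length) (Fin n) (ZMod 2))ᵀ = 1 := by
    ext j i
    rw [Matrix.mul_apply', Matrix.one_apply]
    change ldMat n L Ld j ⬝ᵥ logVec n L i = _
    rw [ldMat, dual_dotProduct_logVec hL i j]
    by_cases h : i = j
    · subst h; simp
    · rw [if_neg h, if_neg (fun e => h e.symm)]
  have hLX : ∀ a, C.HZ *ᵥ ldMat n L Ld a = 0 := fun a => mulVec_dual_eq_zero hL a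
  have hexp : ∀ z, C.HX *ᵥ z = 0 →
      z - (ldMat n L Ld *ᵥ z) ᵥ* (fun i => logVec n L i : Matrix (Fin L.length) (Fin n) (ZMod 2)) ∈ C.rowSpZ :=
    fun z hz => C.sub_label_vecMul_mem_rowSpZ hLX hpair (exists_coeffs_of_ker hcomm hY hS hL hdim hz)
  have hng : (autPerms gens).length = gens.length := List.length_map ..
  intro a z hz hz'
  have hw : ∀ g ∈ a.1, g < (autPerms gens).length := by
    rw [hng]; exact lt_of_autWordsOK hwords a.2
  obtain ⟨ρX, hXsub⟩ := exists_submatrix_eq_wordEquiv (H := Hsyn) (permListOK_of_autGensOK hgens)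
    (rowMapOK_syn_of_autGensOK hgens) a.1 hw
  obtain ⟨ρZ, hZsub⟩ := exists_submatrix_eq_wordEquiv (H := Hstab) (permListOK_of_autGensOK hgens)
    (rowMapOK_stab_of_autGensOK hgens) a.1 hw
  obtain ⟨h1, h2⟩ := C.zLogical_comp_equiv_symm_of_rowMap hXsub hZsub ⟨hz, hz'⟩
  exact ⟨h1, h2, hammingNorm_comp_equiv z _, C.label_comp_equiv_symm hLX hexp hZsub hz⟩

end Transport

/-! ## Smoke tests (kernel `decide` evaluates the checks) -/

/-- `[2,3,0,1]` is a permutation of `4` qubits; `[0,1,1]` is not one of `3`. -/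
example : permListOK 4 [2, 3, 0, 1] = true ∧ permListOK 3 [0, 1, 1] = false := by decide

/-- Swapping the two halves of `4` qubits maps the rows `0011₂, 1100₂` to each other (row map `[1,0]`). -/
example : rowMapOK 4 [3, 12] [2, 3, 0, 1] [1, 0] = true := by decide

/-- The cyclic shift of `3` qubits generates, as words, the shift by two: `wordPerm 3 [[1,2,0]] [0,0] = [2,0,1]`. -/
example : wordPerm 3 [[1, 2, 0]] [0, 0] = [2, 0, 1] := by decide

end Summit.Ventures.QEC.Census
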